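import Mathlib

/-!
# Congruences: Rees congruences and congruences on groups

[Ganyushkin–Mazorchuk 2009, §6.1–§6.2], phrased with Mathlib's congruence relations `Con S`.
A (two-sided) ideal of a semigroup `S` is a nonempty subset `I` with `S I ⊆ I` and `I S ⊆ I`,
spelled out as hypotheses.

* Lemma 6.1.3: a congruence class containing an ideal is an ideal, and at most one class of a
  congruence is an ideal (`class_ideal_of_ideal_subset`, `class_eq_of_ideals`);
* the Rees congruence `ρ_I = (I × I) ∪ Δ` of an ideal `I` is a congruence (`exists_reesCon`);
* Theorem 6.1.6 (first isomorphism theorem, monoid case): Mathlib's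
  `Con.quotientKerEquivOfSurjective` (`nonempty_quotient_ker_mulEquiv`);
* Lemma 6.2.1: the class of `1` is a subsemigroup, for a group a subgroup (`con_one_mul`,
  `con_one_inv`); Lemma 6.2.2: it is normal (`con_one_conj`);
* Theorem 6.2.5: the congruences on a group `G` are exactly the `ρ_H`, `a ρ_H b ⟺ a ∈ bH`, for
  normal subgroups `H` (`exists_con_of_normal` = Mathlib's `QuotientGroup.con`,
  `exists_normal_of_con`), and `G/ρ` is a group (`con_quotient_isGroup`).

## References
* [GanyushkinMazorchuk2009] O. Ganyushkin, V. Mazorchuk, *Classical Finite Transformation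
  Semigroups. An Introduction*, Algebra and Applications 9, Springer, 2009, §6.1–6.2.
-/

namespace Literature.Algebra.Semigroups.Congruence

variable {S : Type*}

/-! ### Lemma 6.1.3 and the Rees congruence -/

/-- Lemma 6.1.3 (first part): if a class `K = [k]` of a congruence `ρ` contains an ideal `I`
(nonempty, `S I S ⊆ I`), then `K` is itself an ideal: for `a ∈ K`, `b ∈ I`, `x ∈ S` one has
`xa ρ xb ∈ I ⊆ K` and `ax ρ bx ∈ I ⊆ K`. [cite: GanyushkinMazorchuk2009, Lemma 6.1.3] -/
theorem class_ideal_of_ideal_subset [Semigroup S] (ρ : Con S) {I : Set S} (hne : I.Nonempty)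
    (hl : ∀ x, ∀ i ∈ I, x * i ∈ I) (hr : ∀ x, ∀ i ∈ I, i * x ∈ I) {k : S}
    (hIK : I ⊆ {a | ρ a k}) {a : S} (ha : ρ a k) (x : S) : ρ (x * a) k ∧ ρ (a * x) k := by
  obtain ⟨b, hb⟩ := hne
  have hab : ρ a b := ρ.trans ha (ρ.symm (hIK hb))
  constructor
  · exact ρ.trans (ρ.mul (ρ.refl x) hab) (hIK (hl x b hb))
  · exact ρ.trans (ρ.mul hab (ρ.refl x)) (hIK (hr x b hb))

/-- Lemma 6.1.3 (second part): two ideals `I, J` always meet (`IJ ⊆ I ∩ J`), so at most one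
class of a congruence can be an ideal: if the classes of `k` and `k'` are ideals then they
coincide. [cite: GanyushkinMazorchuk2009, Lemma 6.1.3] -/
theorem class_eq_of_ideals [Semigroup S] (ρ : Con S) {k k' : S}
    (hr : ∀ x, ∀ i ∈ {a | ρ a k}, i * x ∈ {a | ρ a k})
    (hl' : ∀ x, ∀ j ∈ {a | ρ a k'}, x * j ∈ {a | ρ a k'}) :
    {a | ρ a k} = {a | ρ a k'} := by
  -- `k k'` lies in both classes
  have h1 : ρ (k * k') k := hr k' k (ρ.refl k)
  have h2 : ρ (k * k') k' := hl' k k' (ρ.refl k')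
  have hkk' : ρ k k' := ρ.trans (ρ.symm h1) h2
  ext a
  exact ⟨fun h => ρ.trans h hkk', fun h => ρ.trans h (ρ.symm hkk')⟩

/-- The Rees congruence of an ideal: for an ideal `I` of `S` the relation
`ρ_I = (I × I) ∪ {(a, a)}` is a congruence on `S`. [cite: GanyushkinMazorchuk2009, §6.1] -/
theorem exists_reesCon [Semigroup S] {I : Set S} (hl : ∀ x, ∀ i ∈ I, x * i ∈ I)
    (hr : ∀ x, ∀ i ∈ I, i * x ∈ I) :
    ∃ ρ : Con S, ∀ a b, ρ a b ↔ a = b ∨ (a ∈ I ∧ b ∈ I) := by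
  refine ⟨⟨⟨fun a b => a = b ∨ (a ∈ I ∧ b ∈ I), ⟨fun a => Or.inl rfl, ?_, ?_⟩⟩, ?_⟩,
    fun a b => Iff.rfl⟩
  · rintro a b (rfl | ⟨ha, hb⟩)
    · exact Or.inl rfl
    · exact Or.inr ⟨hb, ha⟩
  · rintro a b c (rfl | ⟨ha, hb⟩) (rfl | ⟨hb', hc⟩)
    · exact Or.inl rfl
    · exact Or.inr ⟨hb', hc⟩
    · exact Or.inr ⟨ha, hb⟩
    · exact Or.inr ⟨ha, hc⟩
  · rintro a b c d (rfl | ⟨ha, hb⟩) (rfl | ⟨hc, hd⟩)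
    · exact Or.inl rfl
    · exact Or.inr ⟨hl a c hc, hl a d hd⟩
    · exact Or.inr ⟨hr c a ha, hr c b hb⟩
    · exact Or.inr ⟨hr c a ha, hr d b hb⟩

/-- Theorem 6.1.6 (monoid case): for an epimorphism `φ : S → T`, `S / Ker φ ≅ T` (Mathlib:
`Con.quotientKerEquivOfSurjective`; the general statement `S / Ker φ ↪ T` is
`Con.quotientKerEquivRange`). [cite: GanyushkinMazorchuk2009, Theorem 6.1.6] -/
theorem nonempty_quotient_ker_mulEquiv {T : Type*} [Monoid S] [Monoid T] (φ : S →* T)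
    (hφ : Function.Surjective φ) : Nonempty ((Con.ker φ).Quotient ≃* T) :=
  ⟨Con.quotientKerEquivOfSurjective φ hφ⟩

/-! ### §6.2: congruences on groups -/

/-- Lemma 6.2.1 (i): for a congruence `ρ` on a monoid the class of `1` is a subsemigroup.
[cite: GanyushkinMazorchuk2009, Lemma 6.2.1 (i)] -/
theorem con_one_mul [Monoid S] (ρ : Con S) {a b : S} (ha : ρ 1 a) (hb : ρ 1 b) :
    ρ 1 (a * b) := by
  have := ρ.mul ha hb
  rwa [one_mul] at this

/-- Lemma 6.2.1 (ii): for a congruence on a group the class of `1` is closed under inverses.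
[cite: GanyushkinMazorchuk2009, Lemma 6.2.1 (ii)] -/
theorem con_one_inv {G : Type*} [Group G] (ρ : Con G) {a : G} (ha : ρ 1 a) : ρ 1 a⁻¹ := by
  have := ρ.mul (ρ.refl a⁻¹) ha
  rw [mul_one, inv_mul_cancel] at this
  exact ρ.symm this

/-- Lemma 6.2.2: the class `H = [1]` of a congruence on a group is normal: `g⁻¹ h g ∈ H`.
[cite: GanyushkinMazorchuk2009, Lemma 6.2.2] -/
theorem con_one_conj {G : Type*} [Group G] (ρ : Con G) {h : G} (hh : ρ 1 h) (g : G) :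
    ρ 1 (g⁻¹ * h * g) := by
  have h1 : ρ g⁻¹ (g⁻¹ * h) := by simpa using ρ.mul (ρ.refl g⁻¹) hh
  have h2 := ρ.mul h1 (ρ.refl g)
  rwa [inv_mul_cancel] at h2

/-- Theorem 6.2.5 (i): for a normal subgroup `H ⊴ G` the relation `a ρ_H b ⟺ a ∈ bH` is a
congruence on `G` (Mathlib: `QuotientGroup.con H`). [cite: GanyushkinMazorchuk2009, Theorem 6.2.5 (i)] -/
theorem exists_con_of_normal {G : Type*} [Group G] (H : Subgroup G) [H.Normal] :
    ∃ ρ : Con G, ∀ a b, ρ a b ↔ b⁻¹ * a ∈ H := by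
  refine ⟨QuotientGroup.con H, fun a b => ?_⟩
  show QuotientGroup.leftRel H a b ↔ _
  rw [QuotientGroup.leftRel_apply, ← H.inv_mem_iff, mul_inv_rev, inv_inv]

/-- Theorem 6.2.5 (ii): every congruence `ρ` on a group `G` is `ρ_H` for the normal subgroup
`H = [1]_ρ`: `a ρ b ⟺ b⁻¹a ∈ H`. [cite: GanyushkinMazorchuk2009, Theorem 6.2.5 (ii)] -/
theorem exists_normal_of_con {G : Type*} [Group G] (ρ : Con G) :
    ∃ H : Subgroup G, H.Normal ∧ (∀ h, h ∈ H ↔ ρ 1 h) ∧ ∀ a b, ρ a b ↔ b⁻¹ * a ∈ H := by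
  let H : Subgroup G :=
    { carrier := {h | ρ 1 h}
      mul_mem' := fun ha hb => con_one_mul ρ ha hb
      one_mem' := ρ.refl 1
      inv_mem' := fun ha => con_one_inv ρ ha }
  have hmem : ∀ h, h ∈ H ↔ ρ 1 h := fun h => Iff.rfl
  refine ⟨H, ⟨fun h hh g => ?_⟩, hmem, fun a b => ?_⟩
  · rw [hmem] at hh ⊢
    simpa using con_one_conj ρ hh g⁻¹
  · rw [hmem]
    constructor
    · intro hab
      simpa using ρ.mul (ρ.refl b⁻¹) (ρ.symm hab)
    · intro h
      have := ρ.mul (ρ.refl b) h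
      rw [mul_one, mul_inv_cancel_left] at this
      exact ρ.symm this

/-- Theorem 6.2.5 (iii): the quotient `G/ρ` of a group by a congruence is a group (every class
is invertible). [cite: GanyushkinMazorchuk2009, Theorem 6.2.5 (iii)] -/
theorem con_quotient_isGroup {G : Type*} [Group G] (ρ : Con G) (x : ρ.Quotient) :
    ∃ y : ρ.Quotient, x * y = 1 ∧ y * x = 1 :=
  ⟨x⁻¹, mul_inv_cancel x, inv_mul_cancel x⟩

end Literature.Algebra.Semigroups.Congruence
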